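import Summits.MatrixMultiplication.MatrixMultiplication.Theses.LevelGradedCohnUmans
import Summits.MatrixMultiplication.MatrixMultiplication.Theorems.LevelTwoBeatsCubes.Negative.GradedNeumannCount
import Summits.MatrixMultiplication.MatrixMultiplication.Theorems.GradedPricing.Negative.LoadBearing
import Summits.MatrixMultiplication.MatrixMultiplication.Theorems.LevelGradedCohnUmansGradedPricing
import Literature.RepresentationTheory.FiniteGroups.IrreducibleCharacters
import Literature.RepresentationTheory.FiniteGroups.NumberOfIrreducibles
import Literature.Computability.AlgebraicComplexity.BCGPUInfiniteGroupsProofs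

/-!
# `GradedDesignFamily` (crux `stmt-MatrixMultiplication-7610`, route `LevelGradedCohnUmans`):
# the exponent-2 endpoint (negative-side support, part 1 of the graded packing law)

Support file of the crux disprover (cdisprove seat, cycle 1); everything `sorry`-free.  A WITNESS
AT `ε` is a finite group `G`, a bi-invariant `J ≤ ℂ^G` and a `J`-separated triple `X, Y, Z` with
`Σᶠ_{χ ∈ Irr(G) ∩ J} χ(1)^(2+ε) < (|X||Y||Z|)^((2+ε)/3)` (the body of the crux).  Write
`D = dim J`, `V = |X||Y||Z|`, `budget_s = Σᶠ_{χ ∈ Irr ∩ J} χ(1)^s`.  Proved here: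

* `one_le_re_apply_one`, `gradedBudget_eq_sum/_nonneg/_mono`, `volume_pos_of_witness` — the
  budget is a genuine finite sum of `d^s`, `d ≥ 1`, monotone in `s`; a witness has `V > 0`;
* `volume_sq_le_finrank_cube`, `rpow_volume_le_finrank` — WALLS `V² ≤ D³` (graded Neumann count
  of crux 7612, `packing_X/Z`);
* `finrank_le_gradedBudget_two` — PETER–WEYL, DIMENSION FORM: `D ≤ budget₂ = Σ_{χ∈J} χ(1)²` for
  bi-invariant `J` (from the landed transfer `le_repFun_charSupport` of the proved sibling crux
  `GradedPricing`: `J ≤ RepFun` of the blocks whose characters it contains, and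
  `dim RepFun ≤ Σ dᵢ²`);
* `rpow_volume_le_gradedBudget_two` — THE EXPONENT-2 ENDPOINT: `V^(2/3) ≤ budget₂` in EVERY
  finite group; hence `not_gradedDesignFamily_closed`: the crux with `0 ≤ ε` in place of `0 < ε`
  is FALSE (no witness at `ε = 0` anywhere) — the open quantifier range of the crux is exactly
  right, and every witness at `ε` must beat a budget that tends to `≥ D ≥ V^(2/3)` as `ε → 0`.
-/

noncomputable section

set_option linter.dupNamespace false

open scoped BigOperators
open Module Literature.RepresentationTheory.FiniteGroups Literature.Computability.AlgebraicComplexity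

namespace Summit.MatrixMultiplication.MatrixMultiplication.Theorems.GradedDesignFamily.Negative

variable {G : Type} [Group G]

/-! ## The graded budget: a finite sum of `d^s`, `d ≥ 1` -/

/-- Each irreducible character has `χ(1) = d ≥ 1`. [folklore] -/
theorem one_le_re_apply_one {χ : G → ℂ} (h : IsIrrChar G χ) : (1 : ℝ) ≤ (χ 1).re := by
  obtain ⟨d, -, hd⟩ := h.exists_apply_one
  have hne := GradedPricing.Negative.apply_one_ne_zero h
  rw [hd] at hne ⊢
  have : d ≠ 0 := fun h0 => hne (by simp [h0])
  simp only [Complex.natCast_re, Nat.one_le_cast]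
  omega

/-- The graded budget as a `Finset` sum. [folklore] -/
theorem gradedBudget_eq_sum [Finite G] (J : Submodule ℂ (G → ℂ)) (s : ℝ) :
    (∑ᶠ χ ∈ irrChars G ∩ (J : Set (G → ℂ)), (χ 1).re ^ ((s) : ℝ)) = ∑ χ ∈ ((irrChars_finite_holds G).subset
      (Set.inter_subset_left : irrChars G ∩ (J : Set (G → ℂ)) ⊆ irrChars G)).toFinset,
        (χ 1).re ^ s :=
  finsum_mem_eq_finite_toFinset_sum _ _

/-- The graded budget is non-negative. [folklore] -/
theorem gradedBudget_nonneg [Finite G] (J : Submodule ℂ (G → ℂ)) (s : ℝ) :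
    0 ≤ (∑ᶠ χ ∈ irrChars G ∩ (J : Set (G → ℂ)), (χ 1).re ^ ((s) : ℝ)) := by
  rw [gradedBudget_eq_sum]
  refine Finset.sum_nonneg fun χ hχ => ?_
  have h := ((Set.Finite.mem_toFinset _).1 hχ).1
  exact Real.rpow_nonneg (zero_le_one.trans (one_le_re_apply_one h)) _

/-- The graded budget is monotone in the exponent. [folklore] -/
theorem gradedBudget_mono [Finite G] (J : Submodule ℂ (G → ℂ)) {s t : ℝ} (hst : s ≤ t) :
    (∑ᶠ χ ∈ irrChars G ∩ (J : Set (G → ℂ)), (χ 1).re ^ ((s) : ℝ)) ≤ (∑ᶠ χ ∈ irrChars G ∩ (J : Set (G → ℂ)), (χ 1).re ^ ((t) : ℝ)) := by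
  rw [gradedBudget_eq_sum, gradedBudget_eq_sum]
  refine Finset.sum_le_sum fun χ hχ => ?_
  have h := ((Set.Finite.mem_toFinset _).1 hχ).1
  exact Real.rpow_le_rpow_of_exponent_le (one_le_re_apply_one h) hst

/-- A witness has positive volume (an empty factor gives `budget < 0`). [folklore] -/
theorem volume_pos_of_witness [Fintype G] {ε : ℝ} (hε : 0 < ε) (J : Submodule ℂ (G → ℂ))
    (X Y Z : Finset G)
    (hlt : (∑ᶠ χ ∈ irrChars G ∩ (J : Set (G → ℂ)), (χ 1).re ^ ((2 + ε) : ℝ)) < ((X.card * Y.card * Z.card : ℕ) : ℝ) ^ ((2 + ε) / 3)) :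
    0 < X.card * Y.card * Z.card := by
  rcases Nat.eq_zero_or_pos (X.card * Y.card * Z.card) with h0 | hpos
  · rw [h0, Nat.cast_zero, Real.zero_rpow (by positivity)] at hlt
    exact absurd hlt (not_lt.2 (gradedBudget_nonneg J _))
  · exact hpos

/-! ## Walls, Peter–Weyl, and the exponent-2 endpoint -/

section Walls

variable [Fintype G]

/-- **Walls** (graded Neumann count of crux 7612): bi-invariant `J`, `J`-separated triple ⇒
`V² ≤ (dim J)³`. [folklore] -/
theorem volume_sq_le_finrank_cube (J : Submodule ℂ (G → ℂ)) (hJ : (∀ f ∈ J, ∀ a b : G, (fun g : G => f (a * g * b)) ∈ J))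
    (X Y Z : Finset G) (h : (∀ x₀ ∈ X, ∀ z₀ ∈ Z, ∃ f ∈ J, ∀ x ∈ X, ∀ y ∈ Y, ∀ y' ∈ Y, ∀ z ∈ Z,
      (x = x₀ ∧ y = y' ∧ z = z₀ → f (x⁻¹ * y * y'⁻¹ * z) = 1) ∧
      (¬ (x = x₀ ∧ y = y' ∧ z = z₀) → f (x⁻¹ * y * y'⁻¹ * z) = 0))) :
    (X.card * Y.card * Z.card) ^ 2 ≤ (finrank ℂ J) ^ 3 := by
  classical
  rcases X.eq_empty_or_nonempty with rfl | ⟨x₁, hx₁⟩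
  · simp
  rcases Y.eq_empty_or_nonempty with rfl | ⟨y₁, hy₁⟩
  · simp
  rcases Z.eq_empty_or_nonempty with rfl | ⟨z₁, hz₁⟩
  · simp
  have hr : ∀ f ∈ J, ∀ t : G, (fun g => f (g * t)) ∈ J := fun f hf t => by
    simpa only [one_mul] using hJ f hf 1 t
  have hl : ∀ f ∈ J, ∀ t : G, (fun g => f (t * g)) ∈ J := fun f hf t => by
    simpa only [mul_one] using hJ f hf t 1
  have N1 := LevelTwoBeatsCubes.Negative.packing_X J hr X Y Z h hy₁ hz₁
  have N2 := LevelTwoBeatsCubes.Negative.packing_Z J hl X Y Z h hx₁ hy₁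
  have ha : 1 ≤ X.card := Finset.card_pos.mpr ⟨x₁, hx₁⟩
  have hc : 1 ≤ Z.card := Finset.card_pos.mpr ⟨z₁, hz₁⟩
  obtain ⟨b, hbY⟩ : ∃ b, Y.card = b + 1 := ⟨Y.card - 1, by
    have := Finset.card_pos.mpr ⟨y₁, hy₁⟩; omega⟩
  rw [hbY] at N1 N2 ⊢
  simp only [Nat.add_sub_cancel] at N1 N2
  set a := X.card
  set c := Z.card
  set D := finrank ℂ J
  have hab : a * (b + 1) ≤ D :=
    calc a * (b + 1) = a * b + a * 1 := by ring
      _ ≤ a * b + a * c := Nat.add_le_add_left (Nat.mul_le_mul_left a hc) _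
      _ = a * c + a * b := Nat.add_comm _ _
      _ ≤ D := N1
  have hac : a * c ≤ D := le_trans (Nat.le_add_right _ _) N1
  have hbc : (b + 1) * c ≤ D :=
    calc (b + 1) * c = 1 * c + b * c := by ring
      _ ≤ a * c + b * c := Nat.add_le_add_right (Nat.mul_le_mul_right c ha) _
      _ ≤ D := N2
  calc (a * (b + 1) * c) ^ 2 = (a * (b + 1)) * ((b + 1) * c) * (a * c) := by ring
    _ ≤ D * D * D := Nat.mul_le_mul (Nat.mul_le_mul hab hbc) hac
    _ = D ^ 3 := by ring

/-- `V^(2/3) ≤ dim J`. [folklore] -/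
theorem rpow_volume_le_finrank (J : Submodule ℂ (G → ℂ)) (hJ : (∀ f ∈ J, ∀ a b : G, (fun g : G => f (a * g * b)) ∈ J))
    (X Y Z : Finset G) (h : (∀ x₀ ∈ X, ∀ z₀ ∈ Z, ∃ f ∈ J, ∀ x ∈ X, ∀ y ∈ Y, ∀ y' ∈ Y, ∀ z ∈ Z,
      (x = x₀ ∧ y = y' ∧ z = z₀ → f (x⁻¹ * y * y'⁻¹ * z) = 1) ∧
      (¬ (x = x₀ ∧ y = y' ∧ z = z₀) → f (x⁻¹ * y * y'⁻¹ * z) = 0))) :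
    ((X.card * Y.card * Z.card : ℕ) : ℝ) ^ ((2 : ℝ) / 3) ≤ (finrank ℂ J : ℝ) := by
  have hsq := volume_sq_le_finrank_cube J hJ X Y Z h
  have hsqR : ((X.card * Y.card * Z.card : ℕ) : ℝ) ^ (2 : ℝ) ≤ ((finrank ℂ J : ℕ) : ℝ) ^ (3 : ℝ) := by
    rw [show (2 : ℝ) = ((2 : ℕ) : ℝ) by norm_num, show (3 : ℝ) = ((3 : ℕ) : ℝ) by norm_num,
      Real.rpow_natCast, Real.rpow_natCast]
    exact_mod_cast hsq
  have hV0 : (0 : ℝ) ≤ ((X.card * Y.card * Z.card : ℕ) : ℝ) := Nat.cast_nonneg _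
  have hD0 : (0 : ℝ) ≤ ((finrank ℂ J : ℕ) : ℝ) := Nat.cast_nonneg _
  calc ((X.card * Y.card * Z.card : ℕ) : ℝ) ^ ((2 : ℝ) / 3)
      = (((X.card * Y.card * Z.card : ℕ) : ℝ) ^ (2 : ℝ)) ^ ((1 : ℝ) / 3) := by
        rw [← Real.rpow_mul hV0]; norm_num
    _ ≤ (((finrank ℂ J : ℕ) : ℝ) ^ (3 : ℝ)) ^ ((1 : ℝ) / 3) :=
        Real.rpow_le_rpow (Real.rpow_nonneg hV0 _) hsqR (by norm_num)
    _ = ((finrank ℂ J : ℕ) : ℝ) := by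
        rw [← Real.rpow_mul hD0]; norm_num

open scoped Classical in
/-- **Peter–Weyl containment, dimension form**: a bi-invariant `J` lies in the span of the matrix
coefficients of the Wedderburn blocks whose characters it contains (`le_repFun_charSupport`, the
transfer step of the proved crux `GradedPricing`), so `dim J ≤ Σ_{χ ∈ Irr(G) ∩ J} χ(1)²`.
[cite: BlasiakCohnGrochowPrattUmans2024, §2.1 (RepFun)] -/
theorem finrank_le_gradedBudget_two (J : Submodule ℂ (G → ℂ)) (hJ : (∀ f ∈ J, ∀ a b : G, (fun g : G => f (a * g * b)) ∈ J)) :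
    (finrank ℂ J : ℝ) ≤ (∑ᶠ χ ∈ irrChars G ∩ (J : Set (G → ℂ)), (χ 1).re ^ ((2) : ℝ)) := by
  obtain ⟨r, d, hd, ⟨φ⟩⟩ := exists_algEquiv_pi_matrix G
  haveI := hd
  let ι := {i : Fin r // (blockRep φ i).character ∈ J}
  let n : ι → ℕ := fun i => d i.1
  let ρ : ∀ i : ι, G →* Matrix.GeneralLinearGroup (Fin (n i)) ℂ := fun i =>
    ((((Pi.evalAlgHom ℂ (fun j : Fin r => Matrix (Fin (d j)) (Fin (d j)) ℂ) i.1).comp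
      φ.toAlgHom).toMonoidHom).comp (MonoidAlgebra.of ℂ G)).toHomUnits
  have hle : J ≤ repFun n ρ := GradedPricing.le_repFun_charSupport φ J hJ
  let F : (Σ i : ι, Fin (n i) × Fin (n i)) → (G → ℂ) := fun k g =>
    ((ρ k.1 g : Matrix.GeneralLinearGroup (Fin (n k.1)) ℂ) : Matrix (Fin (n k.1)) (Fin (n k.1)) ℂ)
      k.2.1 k.2.2
  have hspan : repFun n ρ = Submodule.span ℂ (Set.range F) := by
    unfold repFun
    congr 1
    ext ψ
    simp only [Set.mem_setOf_eq, Set.mem_range]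
    constructor
    · rintro ⟨i, a, b, rfl⟩
      exact ⟨⟨i, (a, b)⟩, rfl⟩
    · rintro ⟨⟨i, a, b⟩, rfl⟩
      exact ⟨i, a, b, rfl⟩
  have h1 : finrank ℂ J ≤ finrank ℂ (repFun n ρ) := Submodule.finrank_mono hle
  have h2 : finrank ℂ (repFun n ρ) ≤ Fintype.card (Σ i : ι, Fin (n i) × Fin (n i)) := by
    rw [hspan]
    exact finrank_range_le_card F
  have h3 : Fintype.card (Σ i : ι, Fin (n i) × Fin (n i)) = ∑ i : ι, (d i.1) ^ 2 := by
    rw [Fintype.card_sigma]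
    refine Finset.sum_congr rfl fun i _ => ?_
    rw [Fintype.card_prod, Fintype.card_fin, sq]
  have h4 : ((∑ i : ι, (d i.1) ^ 2 : ℕ) : ℝ) = ∑ i : ι, ((d i.1 : ℕ) : ℝ) ^ (2 : ℝ) := by
    push_cast
    refine Finset.sum_congr rfl fun i _ => ?_
    rw [Real.rpow_two]
  have h5 := GradedPricing.sum_charSupport_rpow_le φ J 2
  calc (finrank ℂ J : ℝ) ≤ ((∑ i : ι, (d i.1) ^ 2 : ℕ) : ℝ) := by
        exact_mod_cast h1.trans (h3 ▸ h2)
    _ = ∑ i : ι, ((d i.1 : ℕ) : ℝ) ^ (2 : ℝ) := h4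
    _ ≤ _ := h5

/-- **The exponent-2 endpoint**: for EVERY finite group, bi-invariant `J` and `J`-separated
triple, `V^(2/3) ≤ Σ_{χ ∈ Irr ∩ J} χ(1)²` — the crux's inequality at `ε = 0` never holds.
[folklore] -/
theorem rpow_volume_le_gradedBudget_two (J : Submodule ℂ (G → ℂ)) (hJ : (∀ f ∈ J, ∀ a b : G, (fun g : G => f (a * g * b)) ∈ J))
    (X Y Z : Finset G) (h : (∀ x₀ ∈ X, ∀ z₀ ∈ Z, ∃ f ∈ J, ∀ x ∈ X, ∀ y ∈ Y, ∀ y' ∈ Y, ∀ z ∈ Z,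
      (x = x₀ ∧ y = y' ∧ z = z₀ → f (x⁻¹ * y * y'⁻¹ * z) = 1) ∧
      (¬ (x = x₀ ∧ y = y' ∧ z = z₀) → f (x⁻¹ * y * y'⁻¹ * z) = 0))) :
    ((X.card * Y.card * Z.card : ℕ) : ℝ) ^ ((2 : ℝ) / 3) ≤ (∑ᶠ χ ∈ irrChars G ∩ (J : Set (G → ℂ)), (χ 1).re ^ ((2) : ℝ)) :=
  (rpow_volume_le_finrank J hJ X Y Z h).trans (finrank_le_gradedBudget_two J hJ)

end Walls

/-- **The closed-range version of the crux is false**: `GradedDesignFamily` with `0 ≤ ε` in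
place of `0 < ε` fails at `ε = 0` in every group (`rpow_volume_le_gradedBudget_two`); the open
range `0 < ε` of the crux is exactly right. [folklore] -/
theorem not_gradedDesignFamily_closed :
    ¬ ∀ ε : ℝ, 0 ≤ ε → ∃ (G : Type) (_ : Group G) (_ : Fintype G) (J : Submodule ℂ (G → ℂ))
      (X Y Z : Finset G), (∀ f ∈ J, ∀ a b : G, (fun g : G => f (a * g * b)) ∈ J) ∧
      (∀ x₀ ∈ X, ∀ z₀ ∈ Z, ∃ f ∈ J, ∀ x ∈ X, ∀ y ∈ Y, ∀ y' ∈ Y, ∀ z ∈ Z,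
      (x = x₀ ∧ y = y' ∧ z = z₀ → f (x⁻¹ * y * y'⁻¹ * z) = 1) ∧
      (¬ (x = x₀ ∧ y = y' ∧ z = z₀) → f (x⁻¹ * y * y'⁻¹ * z) = 0)) ∧
      (∑ᶠ χ ∈ irrChars G ∩ (J : Set (G → ℂ)), (χ 1).re ^ ((2 + ε) : ℝ)) < ((X.card * Y.card * Z.card : ℕ) : ℝ) ^ ((2 + ε) / 3) := by
  intro hall
  obtain ⟨G, _, _, J, X, Y, Z, hJ, hsep, hlt⟩ := hall 0 le_rfl
  have h := rpow_volume_le_gradedBudget_two J hJ X Y Z hsep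
  have e2 : ((2 : ℝ) + 0) / 3 = 2 / 3 := by norm_num
  rw [e2] at hlt
  simp only [add_zero] at hlt
  exact absurd (hlt.trans_le h) (lt_irrefl _)


end Summit.MatrixMultiplication.MatrixMultiplication.Theorems.GradedDesignFamily.Negative

end
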